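import Summits.BirchSwinnertonDyer.Rank1Residual.ManinAdditive.NeronOmegaGenusHecke
import Summits.BirchSwinnertonDyer.Rank1Residual.ManinConstantOne
import HarnessLib
import HarnessLib.Audit.Tags

/-!
# «GHOST DUALITY: 3 ∣ c_E FORCES A REDUCED-COMPONENT DEFECT ON THE f_E-LINE» — rows E-imc-177 / 178 / 179 + COROLLARY 29.N
# typed (cell `bsd-f2-manin`, planner `imc` g23, MEMO-imc §29, HOME/imc/kit-g23/PROOFS-g23.md; T-imc-35; nothing asserted)

TYPER NOTE (typer g19, T-imc-35).  SOURCE = HOME/imc/kit-g23/Sketch-imc-g23.lean sha16 70a825a099d36334 (121 l.; farm rc 0 · 0 err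
· 0 warn per imc; BC7 3/3 CLEAN, record HOME/imc/kit-g23/g23-bc7.raw.txt 2c3538081111b51f), landed VERBATIM except: (i) this note
and the honest-framing block; (ii) namespace `…ManinAdditive.NeronOmegaGenusG23` folded to `…ManinAdditive.NeronOmegaGenus` (where E-imc-165…176
live; same fold as T-imc-33/34); (iii) `import HarnessLib.Audit.CruxProbe` and the three `#h21_crux_probe` commands dropped; (iv) §3 = three
PROVED typer placement edges (Manin ⟹ law ×2, law ⟹ the 3-part first bit of the printed `c_φ ∣ deg φ` shape), `import …ManinConstantOne`
added for them.  Imports = the sketch's route-independent leaf `NeronOmegaGenusHecke` + `Rank1Residual.ManinConstantOne` — ROUTE-INDEPENDENT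
(no `Theses` module in the cone).  The C3 second line `Cruxes/ManinPrimeToThreeAtNine/Lines/ghost_duality.lean` has STUB 1 = the body of
`ThreeDvdManinForcesRedDefectAtThree` verbatim and cites COROLLARY 29.N; its prose names the node under the sketch namespace `NeronOmegaGenusG23`
— the landed name is `NeronOmegaGenus.ThreeDvdManinForcesRedDefectAtThree`.

HONEST FRAMING.  LENS: imc (integrality of the Néron / Katz–Mazur lattices: Grothendieck duality on the normal Katz–Mazur model of `X₀(N)` at an
additive prime, read on the `e_f`-projection `lineIndex` of the reduced-component lattice `L_red = S ∩ w S` = `drLatticeAtThree N`, resp.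
`kmCuspLatticeGen N` at `p = 2`).  INFORMAL LAW (THEOREM 29.M on paper, PROOFS-g23 §5.4): under the Česnavičius–Neururer–Saha rational-singularity
clause at `p` («p = 3 and either val_p(N) ≤ 2 or there is a prime p' ∣ N with p' ≡ 2 mod 3»; «p = 2 and … p' ≡ 3 mod 4» — quoted from
the materialised text [corpus:paper:arxiv-1911.09446 p.4]), `ord_p(c_φ) = σ^red(φ) + e − k ≤ σ^red(φ) := ord_p deg φ − ord_p [e_f L_red : ℤ f]`
for EVERY parametrisation (`e ≤ k` = GEOMETRIC LEMMA 29.G: `Hom(𝔾_a, Pic⁰(C_ghost^red)) = 0`).  Typed by imc in the contrapositive first-bit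
currency «`p ∣ c` forces `σ^red ≥ 1`» (junk-free: the lattice clause forces `c ≠ 0`).  STATUS: E-imc-177 = PAPER THEOREM pending the referee
audit R-imc-70 (if a gap is found it retires to a law; the typed statement and the sign data stand); E-imc-178 = its `p = 2` twin (bound only);
E-imc-179 = PREDICTION P-g23-W16 (no reliable data yet, D-imc-35(a) asked).  NOT IN PRINT as statements: nearest print BY NAME = the tree fact
`Literature…cesnaviciusNeururerSaha_thm_1_2` (`ord_p c_φ ≤ ord_p deg φ (+ε)`; E-177/178 replace `ord_p deg φ` by the smaller `σ^red(φ)`),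
Edixhoven 1991 (`p ≥ 5` component input), Abbes–Ullmo 1996 (`p ∥ N` Lie algebra); searched by imc (corpus hybrid «Manin constant Lie algebra Néron
model additive reduction», galaxy pdf/panama «Manin constant|Manin's constant»): no bound on `ord_p(c_E)` at an ADDITIVE prime by an explicit
lattice index without a q-expansion-integrality hypothesis found.  BC5 WITNESS (imc, run 2026-08-29T08:20Z, tables HOME/imc/kit-g20/
g20-neronomega-p3-*.txt and -p2-16N-*.txt, ENGINE 7/8): 29.M ∧ Cremona (`c_E = 1`) predict `σ^red ≥ 0` — `p = 3`: 687 optimal rows `9 ∣ N ≤ 1296`,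
`81 ∤ N` (v₃ = 2: 506 zero; v₃ = 3: 168 rat-sing zero + 13 other zero), negative 0/687; `p = 2`: 355 rows `16 ∣ N ≤ 1024` (zero 165, positive 190),
negative 0/355 ⟹ PASS; E-161's own census (670/670 + 436/436, two engines) is the BC5 of COROLLARY 29.N.  REFUTER VERDICTS: ref1 R-imc-70
(PROOFS-g23 §5.3 GEOMETRIC LEMMA 29.G first) PENDING at filing; ref2 PENDING.  CHEAPEST FALSIFIERS (imc): one optimal curve with `σ^red < 0` at a
rat-sing level (kills 29.M); one `9 ∣ N`, `81 ∤ N` optimal class with `σ^red ≠ 0` beyond 1300 (kills E-161, not 29.M).  WHY IT MATTERS: on the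
rat-sing range C3 `ManinPrimeToThreeAtNine` (stmt-BirchSwinnertonDyer-22968) at conductor level follows from E-177 ∧ E-161 (COROLLARY 29.N,
proved below); RESIDUAL of C3 not reached: `27 ∥ N` with all other primes `≡ 1 mod 3`, and `81 ∣ N`.  ANSWER TO THE SEARCH QUESTION at `p = 3`
(imc, rat-sing range): the local invariant controlling `ord₃(c_E)` is `k − e` = (Lie defect of `φ^∨`) − (ghost defect of `λ_f` on `S ∩ w₉S`).
PARTITION currency: ladder-adjacent + frontier-data; beyond-print theorem: NO in Lean (implications between cell statements), paper 29.M not found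
in print; bears_on: stmt-BirchSwinnertonDyer-22968 (C3), stmt-BirchSwinnertonDyer-22967 (C2, E-178 only as a bound).  BSD is not proved by this;
Manin's conjecture is not proved by this; C2/C3 OPEN.
[cite: CesnaviciusNeururerSaha2023, Thm. 1.2 (`ord_p(c_φ) ≤ ord_p(deg φ)` + the rational-singularity clause at `p ∈ {2,3}`, arXiv:1911.09446 §1 p. 4 — the printed shape these rows sharpen; NOT these statements)]
[cite: Edixhoven2006IntegralStructures, Prop. 5 (shape of the `L_red` / Ω-lattice comparison at additive level; `p² ∥ N` deferred there; NOT these statements)]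
[cite: KatzMazur1985, Thm. 13.4.7 with 5.1.1 (the regular model and its special fibre at `p² ∣ N`, the component bookkeeping behind `L_red`; inputs of PROOFS-g23, NOT these statements)]
-/


open scoped MatrixGroups ModularForm
open CongruenceSubgroup Literature.NumberTheory.EllipticCurves.ModularForms
  Summit.BirchSwinnertonDyer.Rank1Residual.ManinAdditive
  Summit.BirchSwinnertonDyer.Rank1Residual.ManinAdditive.NeronOmegaThree
  Summit.BirchSwinnertonDyer.Rank1Residual.ManinAdditive.NeronOmegaGenus
  Summit.BirchSwinnertonDyer.Rank1Residual.ManinAdditive.NeronOmegaTwo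

namespace Summit.BirchSwinnertonDyer.Rank1Residual.ManinAdditive.NeronOmegaGenus

/-! ## §1–§2 The three obligation nodes E-imc-177 / 178 / 179 and COROLLARY 29.N (imc g23, Sketch-imc-g23 VERBATIM) -/

/-- **E-imc-177 `ThreeDvdManinForcesRedDefectAtThree`** (THEOREM 29.M on paper, PROOFS-g23 §5.4, typed contrapositively): for an optimal
`E` (lattice clause) of conductor `N` with `9 ∣ N`, `81 ∤ N`, on the rational-singularity range (Česnavičius–Neururer–Saha (rat-sing-main), verbatim: «p = 3 and either val_p(N) ≤ 2 or there is a
prime p' ∣ N with p' ≡ 2 mod 3»; by PROOFS-g23 (0.2) the second alternative ⟺ `X₀(N/27)_𝔽₃` has no supersingular point with a stabiliser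
of order 3), if `3 ∣ c_E` then the `f`-line of the
reduced-component lattice `L_red = S ∩ wS` (`drLatticeAtThree N`) has depth STRICTLY below `ord₃ deg φ`:
`ord₃ [e_f L_red : ℤ f] < ord₃ deg φ` (i.e. `σ^red(E) ≥ 1`).  Equivalent on paper to `ord₃(c_E) ≤ σ^red(E)`.  Why it might fail: only through
an error in PROOFS-g23 §5 (the inputs are print); the census cannot see it (Cremona: `c_E = 1`), but its sign prediction σ^red ≥ 0 holds 687/687. -/
@[conjecture] def ThreeDvdManinForcesRedDefectAtThree : Prop :=
  ∀ (W : WeierstrassCurve ℚ) [W.IsElliptic] [W.IsGloballyMinimal] [NeZero (W.conductorNorm ℤ)]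
    (D : ModularParametrizationData W (W.conductorNorm ℤ)),
    (∀ z ∈ D.L.lattice, ∃ w ∈ periodLattice D.f, z = D.c * w) →
    9 ∣ W.conductorNorm ℤ → ¬ 81 ∣ W.conductorNorm ℤ →
    (¬ 27 ∣ W.conductorNorm ℤ ∨ ∃ p : ℕ, p.Prime ∧ p ∣ W.conductorNorm ℤ ∧ p % 3 = 2) →
    (3 : ℤ) ∣ D.maninConstant →
      padicValNat 3 (lineIndex (drLatticeAtThree (W.conductorNorm ℤ)) D.f) < padicValNat 3 D.modularDegree

/-- **COROLLARY 29.N (PROVED edge)**: E-imc-177 ∧ E-imc-161 ⟹ `3 ∤ c_E` for every optimal `E` with `9 ∣ N`, `81 ∤ N` on the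
rational-singularity range — the conductor-level core of C3 `ManinPrimeToThreeAtNine` there.  (Binders = E-161's.) -/
theorem not_three_dvd_maninConstant_of_redDefect_of_redDepth
    (h177 : ThreeDvdManinForcesRedDefectAtThree) (h161 : RedDepthEqModularDegreeAtThree)
    (W : WeierstrassCurve ℚ) [W.IsElliptic] [W.IsGloballyMinimal] [NeZero (W.conductorNorm ℤ)]
    (D : ModularParametrizationData W (W.conductorNorm ℤ))
    (hL : ∀ z ∈ D.L.lattice, ∃ w ∈ periodLattice D.f, z = D.c * w)
    (hopt : ∀ (W' : WeierstrassCurve ℚ) [W'.IsElliptic]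
        (D' : ModularParametrizationData W' (W.conductorNorm ℤ)),
        D'.f = D.f → D.modularDegree ≤ D'.modularDegree)
    (h9 : 9 ∣ W.conductorNorm ℤ) (h81 : ¬ 81 ∣ W.conductorNorm ℤ)
    (hrs : ¬ 27 ∣ W.conductorNorm ℤ ∨ ∃ p : ℕ, p.Prime ∧ p ∣ W.conductorNorm ℤ ∧ p % 3 = 2) :
    ¬ (3 : ℤ) ∣ D.maninConstant := fun h3 => by
  have hlt := h177 W D hL h9 h81 hrs h3
  rw [h161 W D hL hopt h9 h81] at hlt
  exact lt_irrefl _ hlt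

/-- The `9 ∥ N` specialisation (no side condition: `val₃(N) = 2` is inside the printed criterion). -/
theorem not_three_dvd_maninConstant_at_nine
    (h177 : ThreeDvdManinForcesRedDefectAtThree) (h161 : RedDepthEqModularDegreeAtThree)
    (W : WeierstrassCurve ℚ) [W.IsElliptic] [W.IsGloballyMinimal] [NeZero (W.conductorNorm ℤ)]
    (D : ModularParametrizationData W (W.conductorNorm ℤ))
    (hL : ∀ z ∈ D.L.lattice, ∃ w ∈ periodLattice D.f, z = D.c * w)
    (hopt : ∀ (W' : WeierstrassCurve ℚ) [W'.IsElliptic]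
        (D' : ModularParametrizationData W' (W.conductorNorm ℤ)),
        D'.f = D.f → D.modularDegree ≤ D'.modularDegree)
    (h9 : 9 ∣ W.conductorNorm ℤ) (h27 : ¬ 27 ∣ W.conductorNorm ℤ) :
    ¬ (3 : ℤ) ∣ D.maninConstant :=
  not_three_dvd_maninConstant_of_redDefect_of_redDepth h177 h161 W D hL hopt h9
    (fun h81 => h27 (Nat.dvd_trans ⟨3, by norm_num⟩ h81)) (Or.inl h27)

/-- **E-imc-178 `TwoDvdManinForcesRedDefectAtTwo`** (the `p = 2` twin of 29.M, PROOFS-g23 §5.6): for an optimal `E` of conductor `N`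
with `16 ∣ N`, `64 ∤ N`, on the rational-singularity range at 2 («p = 2 and … there is a prime p' ∣ N with p' ≡ 3 mod 4»; `val₂(N) ≥ 4` here), `2 ∣ c_E` forces `ord₂ [e_f L_red^gen : ℤ f] < ord₂ deg φ`
(`L_red^gen = kmCuspLatticeGen N`).  BC5: ENGINE 7 p = 2 (HOME/imc/kit-g20/g20-neronomega-p2-16N-*.txt): σ₂^red ≥ 0 on 355/355 optimal
classes (zero 165, positive 190), never negative.  Unlike p = 3, σ₂^red = 0 is NOT a law (190 exceptions), so no C2 turnkey follows. -/
@[conjecture] def TwoDvdManinForcesRedDefectAtTwo : Prop :=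
  ∀ (W : WeierstrassCurve ℚ) [W.IsElliptic] [W.IsGloballyMinimal] [NeZero (W.conductorNorm ℤ)]
    (D : ModularParametrizationData W (W.conductorNorm ℤ)),
    (∀ z ∈ D.L.lattice, ∃ w ∈ periodLattice D.f, z = D.c * w) →
    16 ∣ W.conductorNorm ℤ → ¬ 64 ∣ W.conductorNorm ℤ →
    (∃ p : ℕ, p.Prime ∧ p ∣ W.conductorNorm ℤ ∧ p % 4 = 3) →
    (2 : ℤ) ∣ D.maninConstant →
      padicValNat 2 (lineIndex (kmCuspLatticeGen (W.conductorNorm ℤ)) D.f) < padicValNat 2 D.modularDegree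

/-- **E-imc-179 `OmegaDefectFrickeTrivialAtSixteen`** (PREDICTION P-g23-W16, PROOFS-g23 §4.1): for `N = 16K`, `K` odd, `w₁₆` acts as `+1`
on `G₂(N) = L_red^gen(N)/Ω₂(N)`: `w x − x ∈ Ω₂(N)` for every `x ∈ L_red^gen(N)`.  (The `p = 2` twin of E-imc-170; no reliable data yet —
ENGINE 10's p = 2 W-column was flagged unreliable; second engine asked as D-imc-35(a).  Why it might fail: a wild (order-2-stabiliser)
contribution at the supersingular points of `X₀(K)_𝔽₂` moving `C₂₂^red` off the `w₁₆`-fixed locus.) -/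
@[conjecture] def OmegaDefectFrickeTrivialAtSixteen : Prop :=
  ∀ (K : ℕ) [NeZero K], ¬ 2 ∣ K →
    ∀ x ∈ kmCuspLatticeGen (16 * K), atkinLehnerInvolutionAt (16 * K) 2 2 x - x ∈ omegaLatticeAtTwo (16 * K)

/-! ## §3 Typer placement edges (PROVED; typer g19) -/

/-- **Manin ⟹ E-imc-177.**  Under `ManinConstantOne` a lattice-optimal datum has `|c| = 1`, so `3 ∣ c` is impossible and the
law holds vacuously (placement: E-177 is a weakening of Manin's conjecture, as every «`ord_p(c_E)` …» row for optimal data). -/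
theorem threeDvdManinForcesRedDefectAtThree_of_maninConstantOne (hM : ManinConstant.ManinConstantOne) :
    ThreeDvdManinForcesRedDefectAtThree := by
  intro W _ _ _ D hL _ _ _ h3
  have h1 : |D.maninConstant| = 1 := hM W D hL
  have h2 : (3 : ℤ) ∣ 1 := h1 ▸ (dvd_abs _ _).mpr h3
  exact absurd (Int.eq_one_of_dvd_one (by norm_num) h2) (by norm_num)

/-- **Manin ⟹ E-imc-178** (same vacuity at `p = 2`). -/
theorem twoDvdManinForcesRedDefectAtTwo_of_maninConstantOne (hM : ManinConstant.ManinConstantOne) :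
    TwoDvdManinForcesRedDefectAtTwo := by
  intro W _ _ _ D hL _ _ _ h2c
  have h1 : |D.maninConstant| = 1 := hM W D hL
  have h2 : (2 : ℤ) ∣ 1 := h1 ▸ (dvd_abs _ _).mpr h2c
  exact absurd (Int.eq_one_of_dvd_one (by norm_num) h2) (by norm_num)

/-- **E-imc-177 ⟹ the 3-part first bit of the printed shape `c_φ ∣ deg φ`** (Česnavičius–Neururer–Saha Thm. 1.2 at a rat-sing level,
tree fact `cesnaviciusNeururerSaha_thm_1_2`): on the range, `3 ∣ c_E ⟹ 3 ∣ deg φ` — because `σ^red ≥ 1` forces `ord₃ deg φ ≥ 1`.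
(E-177 is SHARPER than print: it bounds by `σ^red = ord₃ deg φ − ord₃ [e_f L_red : ℤ f]`, not by `ord₃ deg φ`.) -/
theorem three_dvd_modularDegree_of_three_dvd_maninConstant (h177 : ThreeDvdManinForcesRedDefectAtThree)
    (W : WeierstrassCurve ℚ) [W.IsElliptic] [W.IsGloballyMinimal] [NeZero (W.conductorNorm ℤ)]
    (D : ModularParametrizationData W (W.conductorNorm ℤ))
    (hL : ∀ z ∈ D.L.lattice, ∃ w ∈ periodLattice D.f, z = D.c * w)
    (h9 : 9 ∣ W.conductorNorm ℤ) (h81 : ¬ 81 ∣ W.conductorNorm ℤ)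
    (hrs : ¬ 27 ∣ W.conductorNorm ℤ ∨ ∃ p : ℕ, p.Prime ∧ p ∣ W.conductorNorm ℤ ∧ p % 3 = 2)
    (h3 : (3 : ℤ) ∣ D.maninConstant) : 3 ∣ D.modularDegree :=
  dvd_of_one_le_padicValNat (by have := h177 W D hL h9 h81 hrs h3; omega)

end Summit.BirchSwinnertonDyer.Rank1Residual.ManinAdditive.NeronOmegaGenus
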